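import Mathlib
import Summits.NavierStokesRegularity.NavierStokesRegularity.Theorems.EulerZoomLiouvillePowerGaugeEulerLiouvilleSelfSimilarShiftedBoundedC2
import Summits.NavierStokesRegularity.NavierStokesRegularity.Theorems.EulerZoomLiouvillePowerGaugeEulerLiouvilleSelfSimilarSublinearLoc
import HarnessLib

/-!
# The SHIFTED classical stratum of crux E at sublinear growth: an exactly self-similar member about ANY blow-up
# point `(T, x₀)`, `T ≥ 0`, whose `C²` velocity profile is `o(|y|)` is trivial
# (crux `EulerZoomLiouville.PowerGaugeEulerLiouville` = stmt-NavierStokesRegularity-19832, line `birth`, rung C1)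

Route `EulerZoomLiouville` (NavierStokesRegularity).  Joins the two widenings of skeleton v16's classical stratum landed
on 2026-08-28: ns-typeII-p1 g8's SUBLINEAR rigidity `Loc.eq_const_of_sublinear` (a `C²` self-similar Euler profile with
`0 < γ < ½` and `U(y) = o(|y|)` is constant; `…SelfSimilarSublinearLoc`, p589751) and this seat's SHIFTED stratum
(`Shifted.selfSimilar_ae_eq_zero_of_boundedC2_profile`, `…SelfSimilarShiftedBoundedC2`, p589475: members exactly self-similar
about any `(T, x₀)` via the origin-centred EXTENSION `Shifted.isDistributional_selfSimilarCollapse_of_shifted`, p589186).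

* `Shifted.selfSimilar_ae_eq_zero_of_sublinearC2_profile` — distributional Euler pair on the slab + `A`-gauge at the origin
  (`ρ > 0`) + exact self-similarity about `(T, x₀)`, `T ≥ 0` + `V ∈ C²` with
  `∀ δ > 0, ∃ R, ∀ y, R ≤ ‖y‖ → ‖V y‖ ≤ δ‖y‖` ⇒ `u = 0` a.e. on `(−∞,0) × ℝ³`.

Proof = the bounded case verbatim with `Loc.eq_const_of_sublinear` for `Loc.eq_const_of_bounded`: extension ⇒ `P ∈ L¹_loc`
from the slab ⇒ CIV (3.3) classically for some `C¹` pressure (`WeakToClassical.exists_isSelfSimilarEulerProfile_of_contDiff`)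
⇒ `V` constant ⇒ the member's own `A`-gauge kills the constant (`Shifted.const_profile_eq_zero_of_gaugeA`).
WHAT THIS IS NOT: not NS, not E — a classical sub-stratum `--supports` stmt-19832; `C²` profiles of linear-or-faster sparse
growth, the weak class and the genuinely non-self-similar members stay OPEN. [folklore]
-/

noncomputable section

-- flat `Theorems/<Route><Decl>…` files of one crux share the namespace of the crux (tree convention: `Summit.<S>.<S>.…`)
set_option linter.dupNamespace false

open MeasureTheory Set Filter Topology Metric Function TopologicalSpace
open scoped ENNReal NNReal

namespace Summit.NavierStokesRegularity.NavierStokesRegularity.Theorems.PowerGaugeEulerLiouville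

open Literature.Analysis Literature.Analysis.FunctionSpaces Literature.Analysis.FluidPDE

namespace Shifted

/-- **THE SHIFTED CLASSICAL STRATUM AT SUBLINEAR GROWTH, MEMBER LEVEL.**  Let `(u, p)` be a distributional Euler pair on
`(−∞,0) × ℝ³` whose power-gauged scaled energy at the origin obeys `a^{2ρ} A(a; 0) ≤ c` for all `a > 0` (`ρ > 0`), exactly
self-similar about the space–time point `(T, x₀)`, `T ≥ 0`, with the class exponent `γ = 1/(2+ρ)` and profile `(V, P)`.
If `V ∈ C²` has SUBLINEAR GROWTH, `∀ δ > 0, ∃ R, ∀ y, R ≤ ‖y‖ → ‖V y‖ ≤ δ‖y‖`, then `u = 0` a.e. on `(−∞,0) × ℝ³`.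
Contains `Shifted.selfSimilar_ae_eq_zero_of_boundedC2_profile` (bounded ⇒ `o(|y|)`, `Loc.sublinear_of_bounded`); for
`(T, x₀) = (0, 0)` it is ns-typeII-p1 g8's `Loc.selfSimilar_ae_eq_zero_of_sublinearC2_profile` with fewer hypotheses.
[folklore] -/
theorem selfSimilar_ae_eq_zero_of_sublinearC2_profile {ρ : ℝ} (hρ : 0 < ρ) {T : ℝ} (hT : 0 ≤ T)
    (x₀ : EuclideanSpace ℝ (Fin 3))
    {u : ℝ → EuclideanSpace ℝ (Fin 3) → EuclideanSpace ℝ (Fin 3)} {p : ℝ → EuclideanSpace ℝ (Fin 3) → ℝ} {c : ℝ≥0}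
    (hsol : IsDistributionalNSSolutionOn (slab (EuclideanSpace ℝ (Fin 3)) (Iio 0) isOpen_Iio) 0 0 u p)
    (hA : ∀ a : ℝ, 0 < a → ENNReal.ofReal (a ^ (2 * ρ)) *
      cknA a (0 : ℝ × EuclideanSpace ℝ (Fin 3)) u ≤ (c : ℝ≥0∞))
    {V : EuclideanSpace ℝ (Fin 3) → EuclideanSpace ℝ (Fin 3)} {P : EuclideanSpace ℝ (Fin 3) → ℝ}
    (hu : ∀ τ : ℝ, τ < 0 → u τ = fun x => selfSimilarCollapse (1 / (2 + ρ)) T V τ (x - x₀))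
    (hp : ∀ τ : ℝ, τ < 0 → p τ = fun x => selfSimilarCollapsePressure (1 / (2 + ρ)) T P τ (x - x₀))
    (hV : ContDiff ℝ 2 V)
    (hsub : ∀ δ : ℝ, 0 < δ → ∃ R : ℝ, ∀ y : EuclideanSpace ℝ (Fin 3), R ≤ ‖y‖ → ‖V y‖ ≤ δ * ‖y‖) :
    uncurry u =ᵐ[volume.restrict (Iio (0 : ℝ) ×ˢ (univ : Set (EuclideanSpace ℝ (Fin 3))))] 0 := by
  have h2ρ : (0 : ℝ) < 2 + ρ := by linarith
  have hγ : (0 : ℝ) < 1 / (2 + ρ) := one_div_pos.2 h2ρ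
  have hγ2 : 1 / (2 + ρ) < 1 / 2 := one_div_lt_one_div_of_lt two_pos (by linarith)
  -- (1) the origin-centred extension is a distributional Euler pair on the whole slab
  have hext := isDistributional_selfSimilarCollapse_of_shifted hT x₀ hsol hu hp
  -- (2) `P ∈ L¹_loc`
  have hpm : AEStronglyMeasurable (uncurry (selfSimilarCollapsePressure (1 / (2 + ρ)) 0 P))
      (volume.restrict (Iio (0 : ℝ) ×ˢ (univ : Set (EuclideanSpace ℝ (Fin 3))))) := by
    have := hext.2.2.1.aestronglyMeasurable
    simpa [slab] using this
  have hPm : AEStronglyMeasurable P volume :=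
    aestronglyMeasurable_pressureProfile (p := selfSimilarCollapsePressure (1 / (2 + ρ)) 0 P) hpm fun _ _ => rfl
  have hP1 : LocallyIntegrable P volume :=
    locallyIntegrable_pressureProfile_of_slab hγ.le (by linarith) hPm hext.2.2.1
  -- (3) CIV (3.3) classically for some `C¹` pressure, and sublinear rigidity
  obtain ⟨P', hprof⟩ := WeakToClassical.exists_isSelfSimilarEulerProfile_of_contDiff hext
    (fun _ _ => rfl) (fun _ _ => rfl) hV hP1
  have hconst := Loc.eq_const_of_sublinear hprof hsub hγ hγ2
  set b : EuclideanSpace ℝ (Fin 3) := V 0 with hb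
  have hVb : V = fun _ => b := funext fun z => hconst z 0
  -- (4) the member's own `A`-gauge kills the constant
  rw [hVb] at hu
  have hb0 : b = 0 := const_profile_eq_zero_of_gaugeA hρ hT x₀ hu hA
  -- conclusion
  have hS : MeasurableSet (Iio (0 : ℝ) ×ˢ (univ : Set (EuclideanSpace ℝ (Fin 3)))) :=
    measurableSet_Iio.prod MeasurableSet.univ
  refine (ae_restrict_mem hS).mono fun z hz => ?_
  obtain ⟨hτ, -⟩ := hz
  have hτ' : z.1 < 0 := hτ
  change u z.1 z.2 = 0
  rw [hu z.1 hτ']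
  simp [selfSimilarCollapse_apply, hb0]

end Shifted

end Summit.NavierStokesRegularity.NavierStokesRegularity.Theorems.PowerGaugeEulerLiouville

end
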